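import Summits.BirchSwinnertonDyer.Rank1Residual.Additive.GordRatMainConjLowerBound
import Summits.BirchSwinnertonDyer.Rank1Residual.Additive.ChiBranchConstantTermOdd
import HarnessLib

/-!
# The (G)-ordinary cell, defect 2, `p ≡ 3 (mod 4)` (so `p = 3, 7, 11, …`), analytic rank `0`: the LOWER
# divisibility at `T = 0` from a RATIONAL ODD `χ_p`-branch main conjecture for the good-ordinary twist
# plus ONE finite `μ`-certificate (cell `b2b-bsdres`, team n1011, seat n1011-p06, OWNERS row T-N10R, phase 2)

HONEST FRAMING (cell `b2b-bsdres`, run/shared/lean/b2b/bsd-rank1-residual/, verbatim in every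
file): the goal of the cell is to DELETE the COMBINATION-SHAPED residual classes of the
Birch–Swinnerton-Dyer formula for ALL analytic-rank `≤ 1` elliptic curves over `ℚ` — "full BSD
formula for every rank `≤ 1` curve in class `C`" assembled STRICTLY from published theorems — so
that the rank-`≤ 1` remainder becomes exactly the CONSTRUCTION-SHAPED classes, which are TYPED
(missing-input `Prop`s), NOT attempted. This is not "finishing BSD". Team n1011 (X4 ∧ `p = 3` / the
additive block, §I items N10 / N11): research routes; prove what is provable now; no claim beyond
the stated classes; X4♯(G-ord) stays CONSTRUCTION-SHAPED; labels / census / located gap UNCHANGED;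
nothing is booked. One definition (a typed input, nothing asserted) and theorems; no new named fact.

## What and why

Odd twin of `Additive/GordRatMainConjLowerBound.lean` (same seat; the even case `p ≡ 1 (mod 4)`):
on the defect-2 rows at a prime `p ≡ 3 (mod 4)` the additive curve is `E = E♭ ⊗ χ_{−p}` with
`χ_{−p} = ω^{(p−1)/2}` ODD, so the relevant `p`-adic `L`-function of the good-ordinary twist `E♭` is
the ODD branch on the MINUS modular symbols, `padicLFunctionMinusBranch f♭ α (p/2)` (MTT §I.13), whose
constant term `α⁻¹ ∑_{a mod p} (a/p)[a/p]⁻_{f♭}` is a tree theorem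
(`constantCoeff_padicLFunctionMinusBranch_half`, additive-p4), and whose Néron normalisation is
`ϖ⁻ · |Ω⁻(E♭)| = Ω⁻_{f♭}`. At `p = 3` this is the Gord3 locus of N11 (the `(G-ord, e = 2)@3` rows).

* §0 TYPED: `ChiBranchRatCharEqOddAt W p` — the `ω^{(p−1)/2}`-branch (odd) cyclotomic main
  conjecture for the good-ordinary twist as a RATIONAL equality: `X(E/ℚ_∞)` torsion,
  `char_Λ X(E/ℚ_∞) = (g)`, `ι g = p^k · ϖ⁻ · L_p⁻(f♭, α, ω^{(p−1)/2}, T)`, `k ∈ ℤ` (BCS 2025 Thm. 1.1.2 (a)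
  shape). Nothing asserted.
* §1 KERNEL: `cycLowerLeadingTermAt_of_chiBranchRatCharEqOdd_of_unitCoeff` — (§0) + ONE unit
  coefficient of `ϖ⁻ · L_p⁻(…)` ⟹ `k ≥ 0` (`X9.exponent_nonneg_of_exists_norm_coeff_eq_one`) ⟹
  additive-p2's `CycLowerLeadingTermAt W p` (every generator: `f'(0) = c · L(E,1)/Ω_E`, `c ∈ ℤ_p`),
  by MTT §I.14 (minus) and the ODD Birch + Pal identity
  `L(E,1) = ±ϖ⁻·(∑(a/p)[a/p]⁻)·Ω_E/(|u(C)|·c_∞(E))` (`entireLFunction_one_eq_of_twist_neg`, PROVED Pal,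
  `d < 0`; the correcting factor `|u(C)|·c_∞` is a `p`-adic unit: `padicValRat_u_eq_zero_of_twist_pm_p`).
  Valid at EVERY `p ≡ 3 (mod 4)`, `p = 3` included.
* §2 CONSEQUENCES on X4♯(G-ord) ∩ `I₀*`, `p ≡ 3 (mod 4)`, `p ≥ 7`, `r_an = 0`, non-CM: the LOWER half
  on the non-anomalous rows (additive-p2's core + Delbourgo 2002 `hDel`, which needs `p ≥ 5`) and
  `BSD(E,p)` with the printed upper half (Kato half-eigen, `hK`). At `p = 3` the file delivers
  `CycLowerLeadingTermAt W 3` (class form `…_of_ratCharEqOdd_of_unitCoeff`); the Miller-currency end at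
  `3` is the exact-leading-term consumer of OWNERS row T-N10b (n1011-p18), not repeated here.

Located gap: as in the even file — the Eisenstein divisibility of the branch main conjecture,
rationally, is in no printed source; the Kato half is EPW 2006 Thm. 5.1.2 / Kato 2004 Thm. 17.4.
X4♯(G-ord) stays CONSTRUCTION-SHAPED; nothing booked.

References: Burungale–Castella–Skinner, IMRN 2025 Thm. 1.1.2 (a) [BurungaleCastellaSkinner2025];
Mazur–Tate–Teitelbaum, Invent. Math. 84 (1986) §I.8, §I.13–I.14 [MazurTateTeitelbaum1986Invent];
Pal, Proc. AMS (2012) Thm. 3.2 [Pal2012]; Delbourgo, J. Number Theory 95 (2002) Thm. (A), (B)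
[Delbourgo2002]; Kato, Astérisque 295 (2004) Thm. 17.4 [Kato2004Asterisque]; Emerton–Pollack–Weston,
Invent. Math. 163 (2006) Thm. 5.1.2 [EmertonPollackWeston2006]; Greenberg, LNM 1716 (1999) §5
[GreenbergLNM1716]; Miller, LMS J. Comput. Math. 14 (2011) Def. 1.1 [Miller2011LMS].
-/

noncomputable section

open scoped Classical MatrixGroups ModularForm NumberField

open CongruenceSubgroup WeierstrassCurve NumberField Literature.NumberTheory.EllipticCurves
  Literature.NumberTheory.EllipticCurves.ModularForms
  Literature.NumberTheory.EllipticCurves.Rank1Residual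
  Literature.NumberTheory.EllipticCurves.Rank1Residual.Typed
  IsDedekindDomain

namespace Summit.BirchSwinnertonDyer.Rank1Residual.Additive

/-! ### §0 The typed input: the ODD `χ_p`-branch main conjecture of the twist, RATIONAL form -/

/-- **The `ω^{(p−1)/2}`-branch (ODD) cyclotomic main conjecture for the good-ordinary twist, as a
RATIONAL equality, TYPED** (`p ≡ 3 (mod 4)`). For the additive curve `E = W` (globally minimal):
whenever `W` is `ℚ`-isomorphic to the quadratic twist by `−p` of a globally minimal `V = E♭` that is
good ordinary at `p`, `f` is the newform of `V`, `κ`/`γ` is the cyclotomic `ℤ_p`-extension of `ℚ` with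
a topological generator matching the cyclotomic variable, `D` a Pontryagin-dual datum of
`Sel_{p^∞}(W/ℚ_∞)` and `ϖ · |Ω⁻(V)| = Ω⁻_f`, then `X(W/ℚ_∞)` is `Λ`-torsion and
`char_Λ X(W/ℚ_∞) = (g)` with `ι g = p^k · ϖ · L_p⁻(f, α, ω^{(p−1)/2}, T)` for some `k ∈ ℤ`
(`α = unitRoot V p`; the ODD branch on the minus symbols, `padicLFunctionMinusBranch`, MTT §I.13):
BCS 2025 Thm. 1.1.2 (a) SHAPE on the `χ_p`-branch of the twist, Selmer datum of the additive `W`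
over `ℚ_∞`. OPEN — a predicate on `(W, p)`; nothing asserted.
[cite: BurungaleCastellaSkinner2025, Thm. 1.1.2 (a) (shape only; nothing asserted)]
[cite: MazurTateTeitelbaum1986Invent, §I.13 (shape only; nothing asserted)] -/
def ChiBranchRatCharEqOddAt (W : WeierstrassCurve ℚ) (p : ℕ) [Fact p.Prime] : Prop :=
  ∀ (V : WeierstrassCurve ℚ) [V.IsElliptic] [V.IsGloballyMinimal]
    {κ : ZpExtension ℚ p} {γ : Field.absoluteGaloisGroup ℚ} {N : ℕ} [NeZero N]
    {f : CuspForm (Gamma0 N) 2},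
    p % 4 = 3 →
    (∃ C : VariableChange ℚ, C • V.quadraticTwist (-(p : ℚ)) = W) →
    GoodOrd V p →
    κ.IsCyclotomic → κ.IsTopGenerator γ → IsCyclotomicVariable p γ → IsNewformOf V f →
    ∀ (D : W.SelmerDualData κ γ) (ϖ : ℚ), (ϖ : ℝ) * V.imaginaryPeriodRat = minusPeriod f →
      D.IsTorsion ∧
      ∃ (g : IwasawaAlgebra p) (k : ℤ), D.charIdeal = Ideal.span {g} ∧
        iwasawaToPowerSeries p g =
          PowerSeries.C ((p : ℚ_[p]) ^ k * (ϖ : ℚ_[p])) *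
            padicLFunctionMinusBranch f (unitRoot V p : ℚ_[p]) (p / 2)

/-- Unfolding lemma for `ChiBranchRatCharEqOddAt` (to apply the predicate as a function). -/
theorem chiBranchRatCharEqOddAt_iff (W : WeierstrassCurve ℚ) (p : ℕ) [Fact p.Prime] :
    ChiBranchRatCharEqOddAt W p ↔
      ∀ (V : WeierstrassCurve ℚ) [V.IsElliptic] [V.IsGloballyMinimal]
        {κ : ZpExtension ℚ p} {γ : Field.absoluteGaloisGroup ℚ} {N : ℕ} [NeZero N]
        {f : CuspForm (Gamma0 N) 2},
        p % 4 = 3 →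
        (∃ C : VariableChange ℚ, C • V.quadraticTwist (-(p : ℚ)) = W) →
        GoodOrd V p →
        κ.IsCyclotomic → κ.IsTopGenerator γ → IsCyclotomicVariable p γ → IsNewformOf V f →
        ∀ (D : W.SelmerDualData κ γ) (ϖ : ℚ), (ϖ : ℝ) * V.imaginaryPeriodRat = minusPeriod f →
          D.IsTorsion ∧
          ∃ (g : IwasawaAlgebra p) (k : ℤ), D.charIdeal = Ideal.span {g} ∧
            iwasawaToPowerSeries p g =
              PowerSeries.C ((p : ℚ_[p]) ^ k * (ϖ : ℚ_[p])) *
                padicLFunctionMinusBranch f (unitRoot V p : ℚ_[p]) (p / 2) :=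
  Iff.rfl

variable (W : WeierstrassCurve ℚ) [W.IsElliptic] [W.IsGloballyMinimal] (p : ℕ) [hp : Fact p.Prime]

/-! ### §1 The kernel step (odd branch) -/

/-- **Rational ODD `χ_p`-branch main conjecture + ONE unit coefficient ⟹ the LOWER divisibility at
`T = 0`** (`p ≡ 3 (mod 4)`, `p = 3` included). Let `E = W` be globally minimal, additive at `p`, with
`W = C • V^{(−p)}` for a globally minimal `V = E♭` good ordinary at `p`, newform `f`,
`ϖ · |Ω⁻(V)| = Ω⁻_f`. Assume `ChiBranchRatCharEqOddAt W p` (§0) and the certificate `hcert`: some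
coefficient of `ϖ · L_p⁻(f, α, ω^{(p−1)/2}, T)` is a `p`-adic unit. Then `CycLowerLeadingTermAt W p`:
for every generator `f'` of `char_Λ X(E/ℚ_∞)`, `L(E,1)/Ω_E ∣ f'(0)` in `ℤ_p`. Proof:
`k ≥ 0` (`X9.exponent_nonneg_of_exists_norm_coeff_eq_one`); `g(0) = α⁻¹ · p^k ϖ · ∑(a/p)[a/p]⁻_f`
(`constantCoeff_padicLFunctionMinusBranch_half`, MTT §I.14); `L(E,1) = ε ϖ (∑…) Ω_E/(|u(C)| c_∞)`,
`ε = ±1` (`entireLFunction_one_eq_of_twist_neg`; odd Birch + Pal `d < 0`, PROVED; modularity `hmod`),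
with `|u(C)|·c_∞ ∈ ℤ_p^×` (`padicValRat_u_eq_zero_of_twist_pm_p`, `padicValRat_numRealComponents_eq_zero`);
`f' = g·v`, `v ∈ Λ^×`. [cite: MazurTateTeitelbaum1986Invent, §I.14] -/
theorem cycLowerLeadingTermAt_of_chiBranchRatCharEqOdd_of_unitCoeff
    (hmod : hasEntireLFunction_rat) (hp4 : p % 4 = 3) (hadd : Addv W p)
    (V : WeierstrassCurve ℚ) [V.IsElliptic] [V.IsGloballyMinimal]
    (C : VariableChange ℚ) (hC : C • V.quadraticTwist (-(p : ℚ)) = W) (hV : GoodOrd V p)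
    {N : ℕ} [NeZero N] {f : CuspForm (Gamma0 N) 2} (hf : IsNewformOf V f)
    (ϖ : ℚ) (hϖ : (ϖ : ℝ) * V.imaginaryPeriodRat = minusPeriod f)
    (hMC : ChiBranchRatCharEqOddAt W p)
    (hcert : ∃ n : ℕ, ‖PowerSeries.coeff n
        (PowerSeries.C (ϖ : ℚ_[p]) * padicLFunctionMinusBranch f (unitRoot V p : ℚ_[p]) (p / 2))‖ = 1) :
    CycLowerLeadingTermAt W p := by
  have hpP : p.Prime := hp.out
  have hp2 : p ≠ 2 := by omega
  intro κ γ hκ hγ hγ' D f' hf'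
  obtain ⟨-, g, k, hchar, hιg⟩ := hMC V hp4 ⟨C, hC⟩ hV hκ hγ hγ' hf D ϖ hϖ
  -- `k ≥ 0` from the certificate
  have hιg' : iwasawaToPowerSeries p g = PowerSeries.C ((p : ℚ_[p]) ^ k) *
      (PowerSeries.C (ϖ : ℚ_[p]) * padicLFunctionMinusBranch f (unitRoot V p : ℚ_[p]) (p / 2)) := by
    rw [hιg, map_mul, mul_assoc]
  have hk : 0 ≤ k := X9.exponent_nonneg_of_exists_norm_coeff_eq_one g _ k hιg' hcert
  obtain ⟨m, rfl⟩ : ∃ m : ℕ, k = m := ⟨k.toNat, (Int.toNat_of_nonneg hk).symm⟩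
  -- the constant term of `g`: `p^m ϖ · α⁻¹ ∑ (a/p)[a/p]⁻_f`
  have hord : IsOrdinaryAt V p := (isOrdinaryAt_iff V p).mpr ⟨hV.1, hV.2⟩
  obtain ⟨-, hunit⟩ := unitRoot_spec_holds V p hord
  obtain ⟨ua, hua⟩ := hunit
  have h0 := congrArg PowerSeries.constantCoeff hιg
  rw [constantCoeff_iwasawaToPowerSeries, map_mul, PowerSeries.constantCoeff_C,
    constantCoeff_padicLFunctionMinusBranch_half p hp2 V hord hf, ← hua, zpow_natCast] at h0
  -- the `L`-value: `L(E,1) = ε ϖ (∑…) Ω_E / (|u(C)| c_∞)`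
  obtain ⟨ε, hε, hLq⟩ := entireLFunction_one_eq_of_twist_neg p hmod hp4 V W C hC hadd hf ϖ hϖ
  set S : ℚ := legendreMinusSymbolSum f p with hS
  set cinf : ℕ := (W.baseChange ℝ).numRealComponents with hcinf
  have hε0 : ε ≠ 0 := by rcases hε with rfl | rfl <;> norm_num
  have hεv : padicValRat p ε = 0 := by
    rcases hε with rfl | rfl
    · exact padicValRat.one
    · rw [padicValRat.neg]; exact padicValRat.one
  have hua0 : |(C.u : ℚ)| ≠ 0 := abs_ne_zero.mpr C.u.ne_zero
  have hcinf0 : (cinf : ℚ) ≠ 0 := by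
    rw [hcinf, numRealComponents]
    split_ifs <;> norm_num
  have hC'' : C • V.quadraticTwist (((-(p : ℤ)) : ℤ) : ℚ) = W := by push_cast; exact hC
  have hu : padicValRat p (C.u : ℚ) = 0 :=
    padicValRat_u_eq_zero_of_twist_pm_p p hp2 V W (Or.inl hV.1) (Or.inr rfl) C hC''
  have hvua : padicValRat p |(C.u : ℚ)| = 0 := by
    rcases abs_choice (C.u : ℚ) with h | h
    · rw [h]; exact hu
    · rw [h, padicValRat.neg]; exact hu
  have hd0 : ε * (|(C.u : ℚ)| * (cinf : ℚ)) ≠ 0 := mul_ne_zero hε0 (mul_ne_zero hua0 hcinf0)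
  have hdv : padicValRat p (ε * (|(C.u : ℚ)| * (cinf : ℚ))) = 0 := by
    rw [padicValRat.mul hε0 (mul_ne_zero hua0 hcinf0), padicValRat.mul hua0 hcinf0, hεv, hvua,
      hcinf, padicValRat_numRealComponents_eq_zero W p hp2]
    norm_num
  obtain ⟨w, hw⟩ := exists_units_coe_eq_ratCast p hd0 hdv
  -- the identity `ϖ S = (ε |u(C)| c_∞) · (ε ϖ S / (|u(C)| c_∞))` in `ℚ` (`ε² = 1`)
  have key : ϖ * S =
      (ε * (|(C.u : ℚ)| * (cinf : ℚ))) * (ε * (ϖ * S) / (|(C.u : ℚ)| * (cinf : ℚ))) := by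
    have hε2Q : ε ^ 2 = 1 := by rcases hε with rfl | rfl <;> norm_num
    have hdinv : (|(C.u : ℚ)| * (cinf : ℚ)) * (|(C.u : ℚ)| * (cinf : ℚ))⁻¹ = 1 :=
      mul_inv_cancel₀ (mul_ne_zero hua0 hcinf0)
    rw [div_eq_mul_inv]
    linear_combination (-(ϖ * S)) * hε2Q + (-(ϖ * S * ε ^ 2)) * hdinv
  -- the generator `f'` is `g · v`, `v` a unit
  obtain ⟨v, rfl⟩ := exists_units_mul_eq_of_span_eq D hchar hf'
  refine ⟨ε * (ϖ * S) / (|(C.u : ℚ)| * (cinf : ℚ)), hLq,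
    PowerSeries.constantCoeff (v : IwasawaAlgebra p) * ((ua⁻¹ : ℤ_[p]ˣ) : ℤ_[p]) * (w : ℤ_[p]) *
      (p : ℤ_[p]) ^ m, ?_⟩
  -- `f'(0) = g(0) v(0) = p^m ϖ α⁻¹ S v(0)` and `c q = v(0) α⁻¹ w p^m q`, `w q = ϖ S`
  have hq : ((w : ℤ_[p]) : ℚ_[p]) * (((ε * (ϖ * S) / (|(C.u : ℚ)| * (cinf : ℚ))) : ℚ) : ℚ_[p]) =
      (ϖ : ℚ_[p]) * (S : ℚ_[p]) := by
    rw [hw, ← Rat.cast_mul, ← key, Rat.cast_mul]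
  simp only [map_mul, PadicInt.coe_mul, PadicInt.coe_pow, PadicInt.coe_natCast]
  rw [h0, coe_units_inv_eq_inv]
  linear_combination (-(((PowerSeries.constantCoeff (v : IwasawaAlgebra p) : ℤ_[p]) : ℚ_[p]) *
    (((ua : ℤ_[p]) : ℚ_[p]))⁻¹ * (p : ℚ_[p]) ^ m)) * hq

/-! ### §2 Consequences on X4♯(G-ord) ∩ `I₀*`, `p ≡ 3 (mod 4)`: the class forms -/

variable {W p}

/-- **X4♯(G-ord) ∩ `I₀*`, `p ≡ 3 (mod 4)` (`p = 3` included): the integral lower divisibility at `T = 0`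
from the rational ODD branch main conjecture and the `μ`-certificate of the twist.** For
`(E,p) ∈ X4♯(G-ord)` with `e = 2` (`E = E♭ ⊗ χ_{−p}`, `E♭` good ordinary at `p`,
`ClassX4Gord.exists_goodOrd_pStar_twist_model`): `ChiBranchRatCharEqOddAt W p` + the certificate `hcert`
(for every good-ordinary twist model `V` with `C • V^{(−p)} = W`, its newform `f` and
`ϖ · |Ω⁻(V)| = Ω⁻_f`: some coefficient of `ϖ · L_p⁻(f, α, ω^{(p−1)/2}, T)` is a `p`-adic unit) ⟹
`CycLowerLeadingTermAt W p`. Binders: modularity (`hmod`), a modular parametrisation datum for the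
newform / minus period ratio (`hmodD`). At `p = 3` this is the Gord3 locus of N11; the Miller-currency
consumer at `3` is OWNERS row T-N10b's. [cite: MazurTateTeitelbaum1986Invent, §I.14] -/
theorem ClassX4Gord.cycLowerLeadingTermAt_of_ratCharEqOdd_of_unitCoeff
    (hmod : hasEntireLFunction_rat) (hmodD : nonempty_modularParametrizationData)
    (hX : ClassX4Gord W p) (he : semistabilityIndex W p = 2) (hp4 : p % 4 = 3)
    (hMC : ChiBranchRatCharEqOddAt W p)
    (hcert : ∀ (V : WeierstrassCurve ℚ) [V.IsElliptic] [V.IsGloballyMinimal] (C : VariableChange ℚ),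
      GoodOrd V p → C • V.quadraticTwist (-(p : ℚ)) = W →
      ∀ {N : ℕ} [NeZero N] (f : CuspForm (Gamma0 N) 2), IsNewformOf V f →
      ∀ ϖ : ℚ, (ϖ : ℝ) * V.imaginaryPeriodRat = minusPeriod f →
      ∃ n : ℕ, ‖PowerSeries.coeff n
        (PowerSeries.C (ϖ : ℚ_[p]) * padicLFunctionMinusBranch f (unitRoot V p : ℚ_[p]) (p / 2))‖ = 1) :
    CycLowerLeadingTermAt W p := by
  obtain ⟨V, iV, iVm, C, hV, hC⟩ := hX.exists_goodOrd_pStar_twist_model W p he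
  haveI : NeZero (V.conductorNorm ℤ) := ⟨(V.conductorNorm_pos_holds).ne'⟩
  obtain ⟨Dm⟩ := hmodD V
  obtain ⟨ϖ, -, hϖ⟩ := exists_rat_mul_imaginaryPeriodRat_eq_minusPeriod Dm
  have hC' : C • V.quadraticTwist (-(p : ℚ)) = W := by
    rw [pStar_eq_of_mod_four p (Or.inr hp4), if_neg (by omega)] at hC
    exact hC
  exact cycLowerLeadingTermAt_of_chiBranchRatCharEqOdd_of_unitCoeff W p hmod hp4 hX.addv.2 V C hC' hV
    Dm.isNewformOf ϖ hϖ hMC (hcert V C hV hC' Dm.f Dm.isNewformOf ϖ hϖ)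

/-- **X4♯(G-ord) ∩ `I₀*` ∩ non-anomalous, `p ≡ 3 (mod 4)`, `p ≥ 5` (so `p ≥ 7`), `E` non-CM, `r_an = 0`:
the LOWER half `ord_p #Ш_an(E) ≤ ord_p #Ш(E)` from the rational ODD branch main conjecture and the
`μ`-certificate** (through additive-p2's `exists_padicVal_shaAn_of_cycLowerLeadingTerm`, Delbourgo 2002
Thm. (A)+(B) `hDel`, `ℓ = 1` on the non-anomalous rows). X4♯(G-ord) stays CONSTRUCTION-SHAPED.
[cite: Delbourgo2002, Theorem (A), (B) (p. 40)] [cite: BurungaleCastellaSkinner2025, Thm. 1.1.2 (a) (shape only)] -/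
theorem ClassX4Gord.missingLowerBoundAt_rankZero_of_ratCharEqOdd_of_unitCoeff
    (hDel : Delbourgo2002.mainTheorem)
    (hGZK : rank_eq_analyticRank_of_analyticRank_le_one) (hmod : hasEntireLFunction_rat)
    (hmodD : nonempty_modularParametrizationData)
    (hX : ClassX4Gord W p) (he : semistabilityIndex W p = 2) (hp5 : 5 ≤ p) (hp4 : p % 4 = 3)
    (hcm : ¬ W.HasCM) (hr : W.analyticRank = 0) (hna : Delbourgo2002.ReductionNonAnomalous W p)
    (hMC : ChiBranchRatCharEqOddAt W p)
    (hcert : ∀ (V : WeierstrassCurve ℚ) [V.IsElliptic] [V.IsGloballyMinimal] (C : VariableChange ℚ),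
      GoodOrd V p → C • V.quadraticTwist (-(p : ℚ)) = W →
      ∀ {N : ℕ} [NeZero N] (f : CuspForm (Gamma0 N) 2), IsNewformOf V f →
      ∀ ϖ : ℚ, (ϖ : ℝ) * V.imaginaryPeriodRat = minusPeriod f →
      ∃ n : ℕ, ‖PowerSeries.coeff n
        (PowerSeries.C (ϖ : ℚ_[p]) * padicLFunctionMinusBranch f (unitRoot V p : ℚ_[p]) (p / 2))‖ = 1) :
    MissingLowerBoundAt W p := by
  have hLow := ClassX4Gord.cycLowerLeadingTermAt_of_ratCharEqOdd_of_unitCoeff hmod hmodD hX he hp4 hMC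
    hcert
  obtain ⟨q, hq, -, c, ℓ, -, -, hℓ1, hval⟩ :=
    exists_padicVal_shaAn_of_cycLowerLeadingTerm W p hDel hGZK hmod hp5 hcm hX.addv.2 hX.typeGOrd hr
      hLow
  refine ⟨q, hq, ?_⟩
  have hc : 0 ≤ ((c : ℤ_[p]) : ℚ_[p]).valuation := PadicInt.valuation_coe_nonneg
  rw [hℓ1 hna, padicValNat_one_right, Nat.cast_zero, add_zero] at hval
  linarith

/-- **X4♯(G-ord) ∩ `I₀*` ∩ non-anomalous ∩ {`ρ̄_{E,p}` onto}, `p ≡ 3 (mod 4)`, `p ≥ 5`, `E` non-CM,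
`r_an = 0`: `BSD(E,p)` from the rational ODD branch main conjecture and the `μ`-certificate** — lower
half from `ClassX4Gord.missingLowerBoundAt_rankZero_of_ratCharEqOdd_of_unitCoeff`, upper half IN PRINT
(Kato's half-eigen divisibility `hK` through `ClassX4Gord.missingUpperBoundAt_rankZero_of_katoHalf`,
+ Delbourgo 1998 Prop. 4 `hDel98`). Nothing booked. [cite: Kato2004Asterisque, Thm. 17.4 (3) (p. 273)]
[cite: Delbourgo2002, Theorem (A), (B) (p. 40)] [cite: Miller2011LMS, Def. 1.1] -/
theorem ClassX4Gord.bsdp_rankZero_of_ratCharEqOdd_of_unitCoeff_of_katoHalf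
    (hDel : Delbourgo2002.mainTheorem)
    (hK : Wuthrich2014.kato_halfEigenCharIdeal_dvd_cyclotomicPrime_of_surjective)
    (hDel98 : Delbourgo1998.prop4_rankZero_pow_dvd_constantCoeff)
    (hGZK : rank_eq_analyticRank_of_analyticRank_le_one) (hmod : hasEntireLFunction_rat)
    (hmodD : nonempty_modularParametrizationData)
    (hX : ClassX4Gord W p) (he : semistabilityIndex W p = 2) (hp5 : 5 ≤ p) (hp4 : p % 4 = 3)
    (hcm : ¬ W.HasCM) (hr : W.analyticRank = 0) (hna : Delbourgo2002.ReductionNonAnomalous W p)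
    (hsurj : Surj W p) (hMC : ChiBranchRatCharEqOddAt W p)
    (hcert : ∀ (V : WeierstrassCurve ℚ) [V.IsElliptic] [V.IsGloballyMinimal] (C : VariableChange ℚ),
      GoodOrd V p → C • V.quadraticTwist (-(p : ℚ)) = W →
      ∀ {N : ℕ} [NeZero N] (f : CuspForm (Gamma0 N) 2), IsNewformOf V f →
      ∀ ϖ : ℚ, (ϖ : ℝ) * V.imaginaryPeriodRat = minusPeriod f →
      ∃ n : ℕ, ‖PowerSeries.coeff n
        (PowerSeries.C (ϖ : ℚ_[p]) * padicLFunctionMinusBranch f (unitRoot V p : ℚ_[p]) (p / 2))‖ = 1) :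
    BSDp W p :=
  bsdp_of_missingPPartAt W p hGZK (by rw [hr]; exact zero_le_one)
    (missingPPartAt_of_lower_of_upper W p
      (ClassX4Gord.missingLowerBoundAt_rankZero_of_ratCharEqOdd_of_unitCoeff hDel hGZK hmod hmodD hX he
        hp5 hp4 hcm hr hna hMC hcert)
      (ClassX4Gord.missingUpperBoundAt_rankZero_of_katoHalf hK hDel98 hGZK hmod hmodD hX he hr hsurj
        (fun h3 ↦ absurd h3 (by omega))))

end Summit.BirchSwinnertonDyer.Rank1Residual.Additive

end
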